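import Summits.NavierStokesRegularity.NavierStokesRegularity.Theorems.AxisTwistDoorAveragedConeLiouvilleNUWeakEnergySlabIneq
import Summits.NavierStokesRegularity.NavierStokesRegularity.Theorems.AxisTwistDoorAveragedConeLiouvilleNUWeakEnergySteklov
import HarnessLib

/-!
# N4 / T1 piece W1, brick B5 (tools): the `h → 0⁺` limits in W1b

Route `AxisTwistDoor`, crux `AveragedConeLiouville` (stmt-NavierStokesRegularity-26889), INPUT N4 / T1,
programme `kits/N4-T1-skeleton.lean` (118454bf17607d1e), `kits/N4-T1-plan.md` v2 §7 brick (B5):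
`tendsto_integral_cutoff` (dominated convergence for `∫ χ_h(t)F`, `|χ_h| ≤ 1`, `χ_h → 𝟙_{[t₁,t₂]}`),
`tendsto_slab_cutoff_indicator` (the plateau of brick B1 converges pointwise to `𝟙_{[t₁,t₂]}`),
`setIntegral_slab_eq` (Fubini: `∫_{]a,b[×B} ηH(V)Θ² = ∫_{]a,b[} η M`, `M(t) = ∫ H(V(t,x))Θ(x)² dx`),
`setIntegral_Icc_univ_eq_cutoff` (`∫_{[t₁,t₂]×ℝ³} F = ∫_W 𝟙_{[t₁,t₂]}(t) F` for `F` vanishing off the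
unit ball). Consumed by `nu_weakEnergyIdentity` (W1).

WHAT THIS IS NOT: not a statement about Navier–Stokes; T1 is an INPUT; item 26889 and the summit
stay open. [folklore]
-/

noncomputable section

-- the summit and its single sub-problem share the name (CONVENTIONS §1)
set_option linter.dupNamespace false

open MeasureTheory Set Function Filter Topology Metric
open scoped NNReal ENNReal

namespace Summit.NavierStokesRegularity.NavierStokesRegularity.Theorems.AveragedConeLiouville.NUPositivity

/-- **Dominated convergence for time cutoffs:** `∫ χ_h(p.1) F(p) → ∫ 𝟙_{[t₁,t₂]}(p.1) F(p)` as
`h → 0⁺` when `F` is integrable, `|χ_h| ≤ 1`, `χ_h` continuous and `χ_h → 𝟙_{[t₁,t₂]}` pointwise.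
[folklore] -/
theorem tendsto_integral_cutoff {μ : Measure (ℝ × EuclideanSpace ℝ (Fin 3))}
    {F : ℝ × EuclideanSpace ℝ (Fin 3) → ℝ} (hF : Integrable F μ) {t₁ t₂ : ℝ}
    {χ : ℝ → ℝ → ℝ} (hχc : ∀ h, 0 < h → Continuous (χ h)) (hχb : ∀ h, 0 < h → ∀ t, |χ h t| ≤ 1)
    (hχlim : ∀ t, Tendsto (fun h => χ h t) (𝓝[>] 0) (𝓝 ((Icc t₁ t₂).indicator 1 t))) :
    Tendsto (fun h => ∫ p, χ h p.1 * F p ∂μ) (𝓝[>] 0)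
      (𝓝 (∫ p, (Icc t₁ t₂).indicator 1 p.1 * F p ∂μ)) := by
  have hpos : ∀ᶠ h in 𝓝[>] (0 : ℝ), 0 < h := eventually_mem_nhdsWithin
  refine tendsto_integral_filter_of_dominated_convergence (fun p => ‖F p‖) ?_ ?_ hF.norm ?_
  · filter_upwards [hpos] with h hh
    exact ((hχc h hh).comp continuous_fst).aestronglyMeasurable.mul hF.aestronglyMeasurable
  · filter_upwards [hpos] with h hh
    refine Eventually.of_forall fun p => ?_
    rw [norm_mul, Real.norm_eq_abs]
    exact mul_le_of_le_one_left (norm_nonneg _) (hχb h hh p.1)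
  · exact Eventually.of_forall fun p => (hχlim p.1).mul_const _

/-- **The plateau converges pointwise to `𝟙_{[t₁,t₂]}`** (any family with the B1 value clauses).
[folklore] -/
theorem tendsto_slab_cutoff_indicator {t₁ t₂ : ℝ} {χ : ℝ → ℝ → ℝ}
    (hone : ∀ h, 0 < h → ∀ t ∈ Icc t₁ t₂, χ h t = 1)
    (hl : ∀ h, 0 < h → ∀ t, t ≤ t₁ - h → χ h t = 0) (hr : ∀ h, 0 < h → ∀ t, t₂ + h ≤ t → χ h t = 0)
    (t : ℝ) : Tendsto (fun h => χ h t) (𝓝[>] 0) (𝓝 ((Icc t₁ t₂).indicator 1 t)) := by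
  have hpos : ∀ᶠ h in 𝓝[>] (0 : ℝ), 0 < h := eventually_mem_nhdsWithin
  by_cases ht : t ∈ Icc t₁ t₂
  · rw [indicator_of_mem ht, Pi.one_apply]
    refine tendsto_const_nhds.congr' ?_
    filter_upwards [hpos] with h hh using (hone h hh t ht).symm
  rw [indicator_of_notMem ht]
  refine tendsto_const_nhds.congr' ?_
  rcases not_and_or.mp (show ¬ (t₁ ≤ t ∧ t ≤ t₂) from ht) with h1 | h2
  · have hlt : t < t₁ := not_le.mp h1
    filter_upwards [hpos, Ioo_mem_nhdsGT (show (0 : ℝ) < t₁ - t by linarith)] with h hh hh'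
    exact (hl h hh t (by linarith [hh'.2])).symm
  · have hlt : t₂ < t := not_le.mp h2
    filter_upwards [hpos, Ioo_mem_nhdsGT (show (0 : ℝ) < t - t₂ by linarith)] with h hh hh'
    exact (hr h hh t (by linarith [hh'.2])).symm

/-- **Fubini on a time slab:** `∫_{]a,b[×B(0,1)} η H(V)Θ² = ∫_{]a,b[} η(t) ∫ H(V(t,x))Θ(x)² dx dt`.
[folklore] -/
theorem setIntegral_slab_eq {T : ℝ} {V : ℝ → EuclideanSpace ℝ (Fin 3) → ℝ}
    (hVlip : ∃ L, LipschitzOnWith L (uncurry V) (Ioo 0 T ×ˢ ball (0 : EuclideanSpace ℝ (Fin 3)) 1))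
    {H : ℝ → ℝ} (hH : Continuous H) {Θ : EuclideanSpace ℝ (Fin 3) → ℝ} (hΘ : Continuous Θ)
    (hΘ1 : ∀ x, x ∉ ball (0 : EuclideanSpace ℝ (Fin 3)) 1 → Θ x = 0)
    {η : ℝ → ℝ} (hη : Continuous η) {a b : ℝ} (hab : Ioo a b ⊆ Ioo 0 T) :
    ∫ p in Ioo a b ×ˢ ball (0 : EuclideanSpace ℝ (Fin 3)) 1, η p.1 * (H (V p.1 p.2) * Θ p.2 ^ 2) =
      ∫ t in Ioo a b, η t * ∫ x, H (V t x) * Θ x ^ 2 := by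
  have hG := integrableOn_H_comp_mul hVlip hH hΘ
  have hsub : Ioo a b ×ˢ ball (0 : EuclideanSpace ℝ (Fin 3)) 1 ⊆
      Ioo 0 T ×ˢ ball (0 : EuclideanSpace ℝ (Fin 3)) 1 := Set.prod_mono hab Subset.rfl
  have hm : MeasurableSet (Ioo a b ×ˢ ball (0 : EuclideanSpace ℝ (Fin 3)) 1) :=
    measurableSet_Ioo.prod measurableSet_ball
  obtain ⟨Cη, hCη⟩ := isCompact_Icc.exists_bound_of_continuousOn (hη.continuousOn (s := Icc a b))
  have hint : IntegrableOn (fun p : ℝ × EuclideanSpace ℝ (Fin 3) => η p.1 * (H (V p.1 p.2) * Θ p.2 ^ 2))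
      (Ioo a b ×ˢ ball (0 : EuclideanSpace ℝ (Fin 3)) 1) volume := by
    refine (hG.mono_set hsub).bdd_mul (c := Cη) ((hη.comp continuous_fst).aestronglyMeasurable) ?_
    filter_upwards [ae_restrict_mem hm] with p hp
    exact hCη p.1 (Ioo_subset_Icc_self hp.1)
  rw [Measure.volume_eq_prod] at hint
  rw [Measure.volume_eq_prod, setIntegral_prod _ hint]
  refine setIntegral_congr_fun measurableSet_Ioo fun t _ => ?_
  dsimp only
  rw [integral_const_mul, setIntegral_eq_integral_of_forall_compl_eq_zero fun x hx => ?_]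
  rw [hΘ1 x hx]; ring

/-- **`∫_{[t₁,t₂]×ℝ³} F = ∫_{]0,T[×B(0,1)} 𝟙_{[t₁,t₂]}(t)·F`** for `F` vanishing off the unit ball and
`0 < t₁`, `t₂ < T`. [folklore] -/
theorem setIntegral_Icc_univ_eq_cutoff {t₁ t₂ T : ℝ} (h0 : 0 < t₁) (hT : t₂ < T)
    {F : ℝ × EuclideanSpace ℝ (Fin 3) → ℝ}
    (hF0 : ∀ p : ℝ × EuclideanSpace ℝ (Fin 3), p.2 ∉ ball (0 : EuclideanSpace ℝ (Fin 3)) 1 → F p = 0) :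
    ∫ p in Icc t₁ t₂ ×ˢ (univ : Set (EuclideanSpace ℝ (Fin 3))), F p =
      ∫ p in Ioo 0 T ×ˢ ball (0 : EuclideanSpace ℝ (Fin 3)) 1, (Icc t₁ t₂).indicator 1 p.1 * F p := by
  have hmI : MeasurableSet (Icc t₁ t₂ ×ˢ (univ : Set (EuclideanSpace ℝ (Fin 3)))) :=
    measurableSet_Icc.prod MeasurableSet.univ
  have hind : (fun p : ℝ × EuclideanSpace ℝ (Fin 3) => (Icc t₁ t₂).indicator (1 : ℝ → ℝ) p.1 * F p) =
      (Icc t₁ t₂ ×ˢ (univ : Set (EuclideanSpace ℝ (Fin 3)))).indicator F := by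
    funext p
    by_cases hp : p.1 ∈ Icc t₁ t₂
    · rw [indicator_of_mem hp, indicator_of_mem (show p ∈ Icc t₁ t₂ ×ˢ univ from ⟨hp, mem_univ _⟩)]
      simp
    · rw [indicator_of_notMem hp, indicator_of_notMem (show p ∉ Icc t₁ t₂ ×ˢ univ from fun h' => hp h'.1)]
      simp
  rw [hind, integral_indicator hmI, Measure.restrict_restrict hmI, Set.prod_inter_prod, univ_inter,
    inter_eq_left.2 (show Icc t₁ t₂ ⊆ Ioo 0 T from fun t ht => ⟨h0.trans_le ht.1, ht.2.trans_lt hT⟩)]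
  refine setIntegral_eq_of_subset_of_forall_sdiff_eq_zero hmI (Set.prod_mono Subset.rfl (subset_univ _))
    fun p hp => hF0 p fun h' => hp.2 ⟨hp.1.1, h'⟩

end Summit.NavierStokesRegularity.NavierStokesRegularity.Theorems.AveragedConeLiouville.NUPositivity

end
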